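import Summits.BirchSwinnertonDyer.Rank1Residual.X11b.BDPRouteOpenInputOdd
import Summits.BirchSwinnertonDyer.Rank1Residual.X11b.BDPRouteOddPrimeClass
import HarnessLib

/-!
# Class X11b at `p = 3` (team N8/O2, cell `b2b-bsdres`): the Tamagawa sub-atom (T2γ)@3 — an ADDITIVE carrier of a `3`-divisible Tamagawa number — and the ONE input shape that would reach it: a Jetchev-type index bound at `3 ∣ N` (sub-target S2c)

HONEST FRAMING (verbatim, cell `b2b-bsdres`, run/shared/lean/b2b/bsd-rank1-residual/): the goal of
the cell is to DELETE the COMBINATION-SHAPED residual classes for ALL analytic-rank `≤ 1` curves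
over `ℚ` — "full BSD formula for every rank `≤ 1` curve in class `C`" assembled STRICTLY from
published theorems — so that the rank-`≤ 1` remainder becomes exactly the CONSTRUCTION-SHAPED
classes, which are TYPED (missing-input Props), NOT attempted; this is not "finishing BSD".
Research route for class X11b at the prime `p = 3`; no claim beyond the stated class and the
sub-population named in each statement; nothing booked; X11 ∧ `r = 1` at `p = 3` stays
CONSTRUCTION-SHAPED (REFEREE R6.2). THEOREMS ONLY (no definition, no named fact, no `sorry`).

## What this file does

On the Tamagawa atom (T2′)@3 = (ram) ∧ `3 ∣ ∏c_ℓ(E)` the kernel of record types the Euler-system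
half `Typed.MissingUpperBoundAt W 3` WHOLESALE (binder `hU` of `bsdp_of_classX11b_three_of_onTreeInputs`).
Its sub-atoms at `3` (team S2a, `Three.ShapeAlpha/ShapeBeta/ShapeGamma` of
`X11b/Three/TamagawaAtomShapes.lean`): (α) `3 ∣ c_3` (split at `3`, `3 ∣ ord_3 Δ_min`); (β) `3 ∣ c_ℓ`
at a split multiplicative `ℓ ≠ 3` — absorbed by the `N⁻`-device of JSW §7.4.2 (S2b / the
`UpperHalf*.lean` files); (γ) `3 ∣ c_ℓ` at an ADDITIVE `ℓ` (Kodaira IV / IV*, `c_ℓ = 3`) — a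
`p = 3`-ONLY phenomenon (for `p ≥ 5` an additive `c_ℓ ≤ 4` is prime to `p`), which NO printed device
absorbs: only multiplicative primes can be put into `N⁻`. The ONE printed SHAPE that reaches an
additive carrier is Jetchev's Tamagawa-sharpened Kolyvagin bound (Compos. Math. 144 (2008) Thm. 1.4 /
Cor. 1.5: `ord_p #Ш(E/K)[p^∞] + 2·max_{q∣N} ord_p c_q ≤ 2·ord_p[E(K):ℤy_K]`, `q` ANY prime of `N`,
additive included) — printed under Hypothesis (∗) "`p ∤ N`" (p. 812), hence WITHOUT a source at
`3 ∣ N` (referee A G28; harvest-2 GEN 29). This file records what that shape would give: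

* `padicValNat_shaOrder_add_le_of_sharpIndexBound` (data level, every odd `p`, `d_K` odd): from a
  bound of JETCHEV'S SHAPE over `K` with a Tamagawa credit `m` —
  `ord_p #Ш(E/K) + 2m ≤ 2·ord_p[E(K):ℤP]` — the published inputs of the odd chain (Gross–Zagier,
  Kolyvagin, Skinner 2016 Thm. C, GZK, modularity, the X2 sub-cell's odd-`p` twist transport) give
  `#Ш(E)_an = q ∈ ℚ` with `ord_p #Ш(E) + 2m ≤ ord_p q + 2·ord_p ∏_ℓ c_ℓ(E)` — multr1-p2's exact
  Tamagawa defect (`padicValNat_shaOrder_le_add_of_heegnerData_of_odd`, `m = 0`) with the credit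
  carried through;
* `missingUpperBoundAt_of_sharpIndexBound_of_le` — if the credit covers the whole Tamagawa exponent
  (`ord_p ∏_ℓ c_ℓ(E) ≤ m`; for Jetchev's `m = max_q ord_p c_q` this is EXACTLY "a single prime
  carries the `p`-part of `∏c`", Cor. 1.5's "if `p` divides at most one Tamagawa number"), then
  `Typed.MissingUpperBoundAt W p`;
* **`missingUpperBoundAt_of_classX11b_of_ram_of_jetchevShape_odd`** (class level, every odd `p`,
  `p = 3` included): on X11b ∧ (ram), the Euler-system half from the published facts + ONE typed
  input — the SINGLE-CARRIER JETCHEV SHAPE at the odd-`d_K` Manin-good Heegner data of the pair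
  (`ord_p #Ш(E/K) + 2·ord_p ∏_ℓ c_ℓ(E) ≤ 2·ord_p[E(K):ℤP]`, labelled OPEN: no source at `p ∣ N`;
  at `p ∤ N` and a single carrier it is Jetchev Cor. 1.5); this binder is carrier-agnostic, so it
  serves (γ), (β) and (α) alike whenever ONE prime carries the `3`-part of `∏c`;
* `P2.bsdp_of_ram_of_jetchevShape_odd`, **`P2.bsdp_three_of_ram_of_jetchevShape`** — `BSD(E,p)`
  from the twelve published facts of route p2 + THE open input `P2OpenInputOnTreeOddAt W p` + that
  typed bound.

Census (EVIDENCE, two engines, HOME/b2b-bsdres-x11b3-p4/census/; `N < 5·10⁵`): of the 123 739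
X11b@3 class-pairs with (ram) ∧ `3 ∣ ∏c`, 107 245 have a SINGLE `3`-carrier (α 36 606 · β 53 032 ·
γ 17 607) and 16 494 several; of the 567 TRUE-OPEN such classes 160 are single-carrier (α 37 · β 76
· γ 47) and 407 multi-carrier. Nothing here is a source for the binder; CONDITIONAL; nothing booked;
labels UNCHANGED.

References: [Jetchev2008] Hypothesis (∗), Thm. 1.4, Cor. 1.5 (p. 812 = arXiv p. 3);
[JetchevSkinnerWan2017] §7.4.2 (p. 31), (eq:tamK); [Skinner2016PacificMC] Thm. C and footnote 1;
[McCallumLMS1991] §1; [HoffsteinLuo1997] Theorem; [Mazur1978] Cor. 4.1; [Miller2011LMS] Def. 1.1.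
-/

noncomputable section

open scoped Classical

open WeierstrassCurve NumberField IsDedekindDomain Literature.NumberTheory.EllipticCurves
  Literature.NumberTheory.EllipticCurves.ModularForms
  Literature.NumberTheory.EllipticCurves.Rank1Residual
  Literature.NumberTheory.EllipticCurves.Rank1Residual.Typed
  Literature.NumberTheory.EllipticCurves.Wuthrich2014
  Literature.NumberTheory.EllipticCurves.BalakrishnanEtAl2019
  Literature.NumberTheory.EllipticCurves.KrizLi2019
  Literature.NumberTheory.QuadraticFields.Quadratic
  Literature.NumberTheory.GaloisRepresentations Literature.NumberTheory.GaloisCohomology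

namespace Summit.BirchSwinnertonDyer.Rank1Residual.X11b.Three

/-! ### Data level: the Tamagawa defect with a credit `m` (every odd `p`, `d_K` odd) -/

/-- **The Tamagawa defect with a credit, at fixed odd-`d_K` Heegner data — every odd prime `p`.**
Data as in multr1-p2's `padicValNat_shaOrder_le_add_of_heegnerData_of_odd` (X11b-type pair with a
(ram) prime; `K` imaginary quadratic Heegner for `N_E`, `d_K` odd, `p ∤ d_K`, `p ∤ #𝓞_K^×`;
Manin-good datum; `Wd` a globally minimal model of `E^{d_K}`), but with a bound of JETCHEV'S shape
over `K` carrying a Tamagawa credit `m`: `ord_p #Ш(E/K) + 2m ≤ 2·ord_p[E(K):ℤP]` (`hJ`). Conclusion: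
`#Ш(E)_an = q ∈ ℚ` with `ord_p #Ш(E) + 2m ≤ ord_p q + 2·ord_p ∏_ℓ c_ℓ(E)`. Published binders:
Gross–Zagier, Kolyvagin (finiteness), Skinner 2016 Thm. C for the twist (`p ≥ 3`), GZK, modularity;
the transports (a)–(e) are tree theorems (`X2.padicValNat_tamagawaProduct_twist_of_heegner_of_odd`
for (d) at odd `p`). Arithmetic: `v(Ш_W) + v(Ш_d) + 2m = v(Ш_K) + 2m ≤ 2v(I) = v(q) + v(q_d) + v(c_W)
+ 2v(t_d) ≤ v(q) + v(Ш_d) + v(c_d) + v(c_W)`. [cite: JetchevSkinnerWan2017, §7.4.2 (p. 31) and (eq:tamK)]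
[cite: Skinner2016PacificMC, Thm. C (§1) and footnote 1] [cite: Miller2011LMS, Def. 1.1] -/
theorem padicValNat_shaOrder_add_le_of_sharpIndexBound
    (W : WeierstrassCurve ℚ) [W.IsElliptic] [W.IsGloballyMinimal] (p : ℕ) [Fact p.Prime]
    [NeZero (W.conductorNorm ℤ)] (K : Type) [Field K] [NumberField K]
    (Dt : ModularParametrizationData W (W.conductorNorm ℤ))
    (H : HeegnerDatum (W.conductorNorm ℤ) (NumberField.discr K)) (ι : K →+* ℂ)
    (P : (W.baseChange K).toAffine.Point)
    -- the published inputs (named facts of the tree)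
    (hGZ : gross_zagier (W.conductorNorm ℤ) W K) (hKo : kolyvagin (W.conductorNorm ℤ) W K)
    (hSk : Skinner2016.thmC_padicValRat_bsd_rank_zero)
    (hGZK : rank_eq_analyticRank_of_analyticRank_le_one) (hmod : hasEntireLFunction_rat)
    -- the pair
    (hr : W.analyticRank = 1) (hp2 : p ≠ 2) (hmult : Mult W p) (hirr : Irr W p) (hram : Ram W p)
    -- the Heegner data (`d_K` odd, `p ∤ d_K`)
    (hK : IsImaginaryQuadratic K) (hodd : Odd (NumberField.discr K))
    (hpd : ¬ (p : ℤ) ∣ NumberField.discr K)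
    (hHN : SatisfiesHeegnerHypothesis (W.conductorNorm ℤ) K)
    (hP : WeierstrassCurve.Affine.Point.map ι.toRatAlgHom P = heegnerPointComplex Dt H)
    (hc : ¬ (p : ℤ) ∣ Dt.c) (hμ : ¬ p ∣ Units.torsionOrder K)
    (hLt : (W.quadraticTwist (NumberField.discr K : ℚ)).entireLFunction 1 ≠ 0)
    (Wd : WeierstrassCurve ℚ) [Wd.IsElliptic] [Wd.IsGloballyMinimal] (Cd : VariableChange ℚ)
    (hWd : Cd • W.quadraticTwist (NumberField.discr K : ℚ) = Wd)
    -- a bound of Jetchev's shape over `K`, with Tamagawa credit `m`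
    (m : ℕ)
    (hJ : Finite (W.baseChange K).sha → ¬ IsOfFinAddOrder P →
      padicValNat p (Nat.card (W.baseChange K).sha) + 2 * m ≤
        2 * padicValNat p (AddSubgroup.zmultiples P).index) :
    ∃ q : ℚ, shaAn W = (q : ℂ) ∧
      (padicValNat p W.shaOrder : ℤ) + 2 * m ≤
        padicValRat p q + 2 * padicValNat p W.tamagawaProduct := by
  have hp : p.Prime := Fact.out
  have hp3 : 3 ≤ p := by have := hp.two_le; omega
  have hD0 : (NumberField.discr K : ℚ) ≠ 0 := by exact_mod_cast NumberField.discr_ne_zero K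
  haveI hEt : (W.quadraticTwist (NumberField.discr K : ℚ)).IsElliptic :=
    W.isElliptic_quadraticTwist hD0
  -- transports (a)–(e) to the minimal twist model; (d) at odd `p` with `d_K` odd (eisenstein-p2)
  have hmultd : Wd.HasMultiplicativeReductionAtPrime p :=
    hasMultiplicativeReductionAtPrime_twist_of_heegner' W p K hK hHN hmult Cd hWd
  have hirrd : Wd.HasIrreducibleModPGaloisRep p :=
    hasIrreducibleModPGaloisRep_twist_model W p K hK.1 hirr Cd hWd
  have hramd : Ram Wd p := ram_twist_of_heegner W p K hK hHN hram Cd hWd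
  have htam : padicValNat p Wd.tamagawaProduct = padicValNat p W.tamagawaProduct :=
    X2.padicValNat_tamagawaProduct_twist_of_heegner_of_odd W p hp2 K hK hodd hpd hHN Cd hWd
  have hu : padicValRat p (Cd.u : ℚ) = 0 :=
    padicValRat_u_eq_zero_of_twist_minimal W p K hK hHN hmult Cd hWd
  -- the twist: `L(E^D,1) ≠ 0`, finiteness, and Skinner's Thm. C (`p ≥ 3`)
  have hLt' : (W.quadraticTwist (NumberField.discr K : ℚ)).entireLFunction = Wd.entireLFunction := by
    rw [← hWd, entireLFunction_smul]
  have hLd1 : Wd.entireLFunction 1 ≠ 0 := by rw [← hLt']; exact hLt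
  have hrd : Wd.analyticRank = 0 := (Wd.analyticRank_eq_zero_iff_holds (hmod Wd)).2 hLd1
  have hfinSd : Finite Wd.sha := (hGZK Wd (by omega)).2
  obtain ⟨qd, hqd, hvqd⟩ := hSk Wd p hp3 (Or.inr hmultd) hirrd hramd hLd1 hfinSd
  -- the exact bookkeeping at the datum
  obtain ⟨-, hfinK, hsha, q, hq, hval⟩ := exists_shaAn_padicVal_eq_of_heegner W p
    (W.conductorNorm ℤ) K Dt H ι P hGZ hKo hGZK hmod hK hHN hP hp2 hc hμ hr hLt Wd Cd hWd hu qd hqd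
  -- the Heegner point has infinite order
  have hL0 : W.entireLFunction 1 = 0 := entireLFunction_one_eq_zero_of_analyticRank_eq_one hr
  obtain ⟨-, hderiv⟩ := leadingLCoeff_eq_deriv_of_analyticRank_eq_one hr
  have hLK : LDerivEK W K ≠ 0 := by
    rw [lDerivEK_eq_deriv_mul W K hmod hL0]; exact mul_ne_zero hderiv hLt
  have hPinf : ¬ IsOfFinAddOrder P :=
    (lDerivEK_ne_zero_iff_not_isOfFinAddOrder W (W.conductorNorm ℤ) K hGZ hK hHN ⟨Dt, H, ι, hP⟩).mp
      hLK
  have hKU : padicValNat p (W.baseChange K).shaOrder + 2 * m ≤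
      2 * padicValNat p (AddSubgroup.zmultiples P).index := hJ hfinK hPinf
  refine ⟨q, hq, ?_⟩
  haveI : Finite Wd.sha := hfinSd
  have e1 : (padicValNat p (W.baseChange K).shaOrder : ℤ) + 2 * m ≤
      2 * padicValNat p (AddSubgroup.zmultiples P).index := by exact_mod_cast hKU
  have e2 : (padicValNat p (W.baseChange K).shaOrder : ℤ) =
      padicValNat p W.shaOrder + padicValNat p Wd.shaOrder := by exact_mod_cast hsha
  have e3 : (padicValNat p Wd.tamagawaProduct : ℤ) = padicValNat p W.tamagawaProduct := by
    exact_mod_cast htam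
  have e4 := hvqd.le
  omega

/-- **… and if the credit covers the whole Tamagawa exponent, the Euler-system half holds**:
with `ord_p ∏_ℓ c_ℓ(E) ≤ m` (for Jetchev's `m = max_q ord_p c_q(E)`: a SINGLE prime carries the
`p`-part of `∏c` — Cor. 1.5's "if `p` divides at most one Tamagawa number") the previous inequality
is `ord_p #Ш(E) ≤ ord_p #Ш(E)_an`, i.e. `Typed.MissingUpperBoundAt W p`. Bookkeeping on the same
data. [cite: Jetchev2008, Cor. 1.5 (p. 812)] [cite: Miller2011LMS, Def. 1.1] -/
theorem missingUpperBoundAt_of_sharpIndexBound_of_le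
    (W : WeierstrassCurve ℚ) [W.IsElliptic] [W.IsGloballyMinimal] (p : ℕ) [Fact p.Prime]
    [NeZero (W.conductorNorm ℤ)] (K : Type) [Field K] [NumberField K]
    (Dt : ModularParametrizationData W (W.conductorNorm ℤ))
    (H : HeegnerDatum (W.conductorNorm ℤ) (NumberField.discr K)) (ι : K →+* ℂ)
    (P : (W.baseChange K).toAffine.Point)
    (hGZ : gross_zagier (W.conductorNorm ℤ) W K) (hKo : kolyvagin (W.conductorNorm ℤ) W K)
    (hSk : Skinner2016.thmC_padicValRat_bsd_rank_zero)
    (hGZK : rank_eq_analyticRank_of_analyticRank_le_one) (hmod : hasEntireLFunction_rat)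
    (hr : W.analyticRank = 1) (hp2 : p ≠ 2) (hmult : Mult W p) (hirr : Irr W p) (hram : Ram W p)
    (hK : IsImaginaryQuadratic K) (hodd : Odd (NumberField.discr K))
    (hpd : ¬ (p : ℤ) ∣ NumberField.discr K)
    (hHN : SatisfiesHeegnerHypothesis (W.conductorNorm ℤ) K)
    (hP : WeierstrassCurve.Affine.Point.map ι.toRatAlgHom P = heegnerPointComplex Dt H)
    (hc : ¬ (p : ℤ) ∣ Dt.c) (hμ : ¬ p ∣ Units.torsionOrder K)
    (hLt : (W.quadraticTwist (NumberField.discr K : ℚ)).entireLFunction 1 ≠ 0)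
    (Wd : WeierstrassCurve ℚ) [Wd.IsElliptic] [Wd.IsGloballyMinimal] (Cd : VariableChange ℚ)
    (hWd : Cd • W.quadraticTwist (NumberField.discr K : ℚ) = Wd)
    (m : ℕ) (hm : padicValNat p W.tamagawaProduct ≤ m)
    (hJ : Finite (W.baseChange K).sha → ¬ IsOfFinAddOrder P →
      padicValNat p (Nat.card (W.baseChange K).sha) + 2 * m ≤
        2 * padicValNat p (AddSubgroup.zmultiples P).index) :
    Typed.MissingUpperBoundAt W p := by
  obtain ⟨q, hq, hle⟩ := padicValNat_shaOrder_add_le_of_sharpIndexBound W p K Dt H ι P hGZ hKo hSk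
    hGZK hmod hr hp2 hmult hirr hram hK hodd hpd hHN hP hc hμ hLt Wd Cd hWd m hJ
  refine ⟨q, hq, ?_⟩
  have hm' : (padicValNat p W.tamagawaProduct : ℤ) ≤ m := by exact_mod_cast hm
  omega

/-! ### Class level: the Euler-system half on X11b ∧ (ram) from the single-carrier Jetchev shape -/

section ClassLevel

variable (W : WeierstrassCurve ℚ) [W.IsElliptic] [W.IsGloballyMinimal] (p : ℕ) [Fact p.Prime]

/-- **X11b ∧ (ram), every ODD `p` (`p = 3` included): the Euler-system half from the published
facts + the SINGLE-CARRIER JETCHEV SHAPE at the pair.** TYPED input `hJet` (labelled OPEN — NO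
source at `p ∣ N`: Jetchev, Compos. Math. 144 (2008) Thm. 1.4 / Cor. 1.5 are printed under
Hypothesis (∗) "`p ∤ N`", p. 812; at `p ∤ N` with a single carrier the display IS Cor. 1.5): at every
odd-`d_K` Manin-good Heegner datum of the pair (`K` imaginary quadratic Heegner for `N_E`, `d_K` odd,
`p ∤ d_K`, `p ∤ #𝓞_K^×`, `L(E^{d_K},1) ≠ 0`, `p ∤ c(Dt)`, `P` the Heegner point, non-torsion, `Ш(E/K)`
finite), `ord_p #Ш(E/K) + 2·ord_p ∏_ℓ c_ℓ(E) ≤ 2·ord_p[E(K):ℤP]`. PUBLISHED binders: Gross–Zagier,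
Kolyvagin, Skinner 2016 Thm. C, GZK, modularity ×2, Hoffstein–Luo (the odd-`d_K` field), Mazur 1978
Cor. 4.1, Néron scaling (tree theorem). The binder is carrier-agnostic: it reaches the ADDITIVE
carrier sub-atom (γ)@3 (Kodaira IV/IV*, `c_ℓ = 3`; no `N⁻`-device) as well as (β) and (α), exactly on
the pairs where ONE prime carries the `p`-part of `∏c` (census: 107 245 of the 123 739 X11b@3
class-pairs with (ram) ∧ `3 ∣ ∏c`; 160 of the 567 TRUE-OPEN). CONDITIONAL; nothing booked; X11b /
X11 ∧ `r = 1` at `p = 3` stay CONSTRUCTION-SHAPED. [cite: Jetchev2008, Hypothesis (*), Thm. 1.4, Cor. 1.5 (p. 812)]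
[cite: JetchevSkinnerWan2017, §7.4.2 (p. 31)] [cite: Skinner2016PacificMC, Thm. C (§1) and footnote 1]
[cite: HoffsteinLuo1997, Theorem (§1)] [cite: Mazur1978, Cor. 4.1] [cite: Miller2011LMS, Def. 1.1] -/
theorem missingUpperBoundAt_of_classX11b_of_ram_of_jetchevShape_odd
    -- published inputs (named facts of the tree)
    (hGZ : ∀ (N : ℕ) [NeZero N] (W : WeierstrassCurve ℚ) (K : Type) [Field K] [NumberField K],
      gross_zagier N W K)
    (hKo : ∀ (N : ℕ) [NeZero N] (W : WeierstrassCurve ℚ) (K : Type) [Field K] [NumberField K],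
      kolyvagin N W K)
    (hSk : Skinner2016.thmC_padicValRat_bsd_rank_zero)
    (hGZK : rank_eq_analyticRank_of_analyticRank_le_one) (hmod : hasEntireLFunction_rat)
    (hnf : exists_isNewformOf) (hHL : HoffsteinLuo1997_exists_twist_L_one_ne_zero)
    (hMaz : mazur_not_dvd_maninConstant_of_odd)
    -- the SINGLE-CARRIER JETCHEV SHAPE at the pair (typed; OPEN at `p ∣ N`)
    (hJet : ∀ (N : ℕ) [NeZero N] (K : Type) [Field K] [NumberField K]
      (Dt : ModularParametrizationData W N) (H : HeegnerDatum N (NumberField.discr K)) (ι : K →+* ℂ)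
      (P : (W.baseChange K).toAffine.Point),
      W.conductorNorm ℤ = N → IsImaginaryQuadratic K → Odd (NumberField.discr K) →
      ¬ (p : ℤ) ∣ NumberField.discr K → ¬ p ∣ Units.torsionOrder K → SatisfiesHeegnerHypothesis N K →
      (W.quadraticTwist (NumberField.discr K : ℚ)).entireLFunction 1 ≠ 0 →
      WeierstrassCurve.Affine.Point.map ι.toRatAlgHom P = heegnerPointComplex Dt H →
      ¬ (p : ℤ) ∣ Dt.c → Finite (W.baseChange K).sha → ¬ IsOfFinAddOrder P →
      padicValNat p (Nat.card (W.baseChange K).sha) + 2 * padicValNat p W.tamagawaProduct ≤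
        2 * padicValNat p (AddSubgroup.zmultiples P).index)
    (hX : ClassX11b W p) (hram : Ram W p) : Typed.MissingUpperBoundAt W p := by
  obtain ⟨hr, hp2, hmult, hirr⟩ := hX
  haveI : NeZero (W.conductorNorm ℤ) := ⟨(W.conductorNorm_pos_holds).ne'⟩
  obtain ⟨K, _, _, Dt, H, ι, P, Wd, _, _, Cd, hK, hodd, hpd, hHN, hP, hc, hμ, hLt, hWd⟩ :=
    exists_oddHeegnerData hnf hHL hMaz integral_neronScaling_of_isGloballyMinimal_holds W p hr hp2
      hmult hirr
  exact missingUpperBoundAt_of_sharpIndexBound_of_le W p K Dt H ι P (hGZ _ W K) (hKo _ W K) hSk hGZK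
    hmod hr hp2 hmult hirr hram hK hodd hpd hHN hP hc hμ hLt Wd Cd hWd (padicValNat p W.tamagawaProduct)
    le_rfl (hJet _ K Dt H ι P rfl hK hodd hpd hμ hHN hLt hP hc)

/-- **Route p2 at an ODD prime on X11b ∧ (ram) with the single-carrier Jetchev shape** (`p = 3`
included): `BSD(E,p)` from the twelve published facts of the route, THE open input
`P2OpenInputOnTreeOddAt W p` [(IMC≥∘BDP)ᵗ; at `p ∥ N`, `p ≥ 5`: erratum (2.4) ⇐ FW21 Thm. 4.41,
UNREFEREED; at `p = 3`: NO source] and the typed single-carrier Jetchev shape `hJet` [NO source at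
`p ∣ N`]. Lower half `P2.missingLowerBoundAt_of_openInputOddAt` (`ρ̄_{E,p}` onto by
`surj_of_irr_of_ram`), upper half `missingUpperBoundAt_of_classX11b_of_ram_of_jetchevShape_odd`.
CONDITIONAL; nothing booked; labels UNCHANGED. [cite: Jetchev2008, Thm. 1.4, Cor. 1.5 (p. 812)]
[cite: Castella2018, Thm. 2.3 (p. 5), Thm. 3.2 (p. 9)] [cite: Castella2018Erratum, (2.4) (p. 1)]
[cite: Skinner2016PacificMC, Thm. C (§1) and footnote 1] [cite: Wuthrich2014, Prop. 21 (p. 400)] [cite: Miller2011LMS, Def. 1.1] -/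
theorem P2.bsdp_of_ram_of_jetchevShape_odd
    (hGZ : ∀ (N : ℕ) [NeZero N] (W : WeierstrassCurve ℚ) (K : Type) [Field K] [NumberField K],
      gross_zagier N W K)
    (hKo : ∀ (N : ℕ) [NeZero N] (W : WeierstrassCurve ℚ) (K : Type) [Field K] [NumberField K],
      kolyvagin N W K)
    (hSk : Skinner2016.thmC_padicValRat_bsd_rank_zero) (hWu : sha_dvd_analyticSha)
    (hGZK : rank_eq_analyticRank_of_analyticRank_le_one) (hmod : hasEntireLFunction_rat)
    (hnf : exists_isNewformOf) (hHL : HoffsteinLuo1997_exists_twist_L_one_ne_zero)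
    (hMaz : mazur_not_dvd_maninConstant_of_odd)
    (hPT : ∀ (K : Type) [Field K] [NumberField K], poitouTate_sum_localTatePairing_eq_zero K)
    (hEP : ∀ (K : Type) [Field K] [NumberField K] (v : HeightOneSpectrum (𝓞 K)),
      localEulerPoincareCharacteristic (v.adicCompletion K))
    (hA : P2OpenInputOnTreeOddAt W p)
    (hJet : ∀ (N : ℕ) [NeZero N] (K : Type) [Field K] [NumberField K]
      (Dt : ModularParametrizationData W N) (H : HeegnerDatum N (NumberField.discr K)) (ι : K →+* ℂ)
      (P : (W.baseChange K).toAffine.Point),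
      W.conductorNorm ℤ = N → IsImaginaryQuadratic K → Odd (NumberField.discr K) →
      ¬ (p : ℤ) ∣ NumberField.discr K → ¬ p ∣ Units.torsionOrder K → SatisfiesHeegnerHypothesis N K →
      (W.quadraticTwist (NumberField.discr K : ℚ)).entireLFunction 1 ≠ 0 →
      WeierstrassCurve.Affine.Point.map ι.toRatAlgHom P = heegnerPointComplex Dt H →
      ¬ (p : ℤ) ∣ Dt.c → Finite (W.baseChange K).sha → ¬ IsOfFinAddOrder P →
      padicValNat p (Nat.card (W.baseChange K).sha) + 2 * padicValNat p W.tamagawaProduct ≤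
        2 * padicValNat p (AddSubgroup.zmultiples P).index)
    (hX : ClassX11b W p) (hram : Ram W p) : BSDp W p := by
  have hsurj : Surj W p := surj_of_irr_of_ram W p hX.2.2.2 hram
  refine Typed.bsdp_of_missingPPartAt W p hGZK (by rw [hX.1]) ?_
  exact Typed.missingPPartAt_of_lower_of_upper W p
    (P2.missingLowerBoundAt_of_openInputOddAt W p hGZ hKo hWu hGZK hmod hnf hHL hMaz hPT hEP hA hX
      hsurj)
    (missingUpperBoundAt_of_classX11b_of_ram_of_jetchevShape_odd W p hGZ hKo hSk hGZK hmod hnf hHL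
      hMaz hJet hX hram)

end ClassLevel

/-- **The `p = 3` row**: `BSD(E,3)` for every `E` with `(E,3) ∈` X11b and a (ram) prime — ANY
Tamagawa numbers, in particular on the additive-carrier sub-atom (γ)@3 — from the published facts,
THE open input at `3` (`P2OpenInputOnTreeOddAt W 3`, NO source) and the single-carrier Jetchev shape
at `3` (NO source at `3 ∣ N`; it is a sensible ask only where ONE prime carries the `3`-part of
`∏c`: 107 245 of 123 739 class-pairs, 160 of 567 TRUE-OPEN). The `p = 3` case of
`P2.bsdp_of_ram_of_jetchevShape_odd`. CONDITIONAL; nothing booked; X11 ∧ `r = 1` at `p = 3` stays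
CONSTRUCTION-SHAPED. [cite: Jetchev2008, Thm. 1.4, Cor. 1.5 (p. 812)] [cite: Castella2018, Thm. 2.3 (p. 5), Thm. 3.2 (p. 9)]
[cite: Skinner2016PacificMC, Thm. C (§1) and footnote 1] [cite: Wuthrich2014, Prop. 21 (p. 400)] [cite: Miller2011LMS, Def. 1.1] -/
theorem P2.bsdp_three_of_ram_of_jetchevShape [Fact (Nat.Prime 3)]
    (hGZ : ∀ (N : ℕ) [NeZero N] (W : WeierstrassCurve ℚ) (K : Type) [Field K] [NumberField K],
      gross_zagier N W K)
    (hKo : ∀ (N : ℕ) [NeZero N] (W : WeierstrassCurve ℚ) (K : Type) [Field K] [NumberField K],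
      kolyvagin N W K)
    (hSk : Skinner2016.thmC_padicValRat_bsd_rank_zero) (hWu : sha_dvd_analyticSha)
    (hGZK : rank_eq_analyticRank_of_analyticRank_le_one) (hmod : hasEntireLFunction_rat)
    (hnf : exists_isNewformOf) (hHL : HoffsteinLuo1997_exists_twist_L_one_ne_zero)
    (hMaz : mazur_not_dvd_maninConstant_of_odd)
    (hPT : ∀ (K : Type) [Field K] [NumberField K], poitouTate_sum_localTatePairing_eq_zero K)
    (hEP : ∀ (K : Type) [Field K] [NumberField K] (v : HeightOneSpectrum (𝓞 K)),
      localEulerPoincareCharacteristic (v.adicCompletion K))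
    (W : WeierstrassCurve ℚ) [W.IsElliptic] [W.IsGloballyMinimal]
    (hA : P2OpenInputOnTreeOddAt W 3)
    (hJet : ∀ (N : ℕ) [NeZero N] (K : Type) [Field K] [NumberField K]
      (Dt : ModularParametrizationData W N) (H : HeegnerDatum N (NumberField.discr K)) (ι : K →+* ℂ)
      (P : (W.baseChange K).toAffine.Point),
      W.conductorNorm ℤ = N → IsImaginaryQuadratic K → Odd (NumberField.discr K) →
      ¬ (3 : ℤ) ∣ NumberField.discr K → ¬ 3 ∣ Units.torsionOrder K → SatisfiesHeegnerHypothesis N K →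
      (W.quadraticTwist (NumberField.discr K : ℚ)).entireLFunction 1 ≠ 0 →
      WeierstrassCurve.Affine.Point.map ι.toRatAlgHom P = heegnerPointComplex Dt H →
      ¬ (3 : ℤ) ∣ Dt.c → Finite (W.baseChange K).sha → ¬ IsOfFinAddOrder P →
      padicValNat 3 (Nat.card (W.baseChange K).sha) + 2 * padicValNat 3 W.tamagawaProduct ≤
        2 * padicValNat 3 (AddSubgroup.zmultiples P).index)
    (hX : ClassX11b W 3) (hram : Ram W 3) : BSDp W 3 :=
  P2.bsdp_of_ram_of_jetchevShape_odd W 3 hGZ hKo hSk hWu hGZK hmod hnf hHL hMaz hPT hEP hA hJet hX hram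

end Summit.BirchSwinnertonDyer.Rank1Residual.X11b.Three

end
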